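import Mathlib
import Literature.Geometry.Symplectic.JHolomorphicMap

/-!
# Coordinates adapted to a `J`-holomorphic curve (stubs `helper_adaptedMapHol`, `helper_adaptedMapInverse`)

Crux `TameOrBrodyR4` (stmt-SmoothPoincare4-7826), line `Sketch`, skeleton v16: the classical
device of McDuff–Salamon (coordinates near a point of a `J`-curve in which `J` is standard ALONG
the curve), realised by the explicit *adapted map* along a smooth `v : ℂ → ℝ⁴` with a vector `e`,

  `E (ζ, ω) = v ζ + ω.re • e + ω.im • J (v ζ) e`.

* `helper_adaptedMapHol` (AC-a): `E` is `C^∞`, `E (ζ, 0) = v ζ`, and along `{ω = 0}` the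
  differential `dE_(ζ,0) (α, β) = dv_ζ α + β.re • e + β.im • J e` intertwines multiplication by
  `i` with `J (v ζ)`: `J (dv α) = dv (i α)` because `v` is `J`-holomorphic, and
  `J (β.re • e + β.im • J e) = β.re • J e - β.im • e`, which is the `e, J e`-part of
  `dE (iα, iβ)` since `(iβ).re = -β.im`, `(iβ).im = β.re`.
* `helper_adaptedMapInverse` (AC-b): if `dv_{ξ₁}` is injective, choose `e ∉ range dv_{ξ₁}` (a real
  `2`-plane in `ℝ⁴` is not everything); then `dE_{(ξ₁,0)}` is injective (apply `J` to a vanishing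
  combination and eliminate `J e`: `(s² + t²) e ∈ range dv`), hence bijective (`4 = 4`); the
  inverse function theorem gives a smooth local inverse `Λ`, and continuity of `p ↦ dE_p` gives a
  uniform lower bound `‖q‖ ≤ B ‖dE_p q‖` on a small ball.

References: D. McDuff, D. Salamon, *J-holomorphic curves and symplectic topology*, 2nd ed. (2012),
§2.4 and App. E (local normal forms along a curve).
-/

set_option linter.dupNamespace false

noncomputable section

open Filter Set Metric Literature.Geometry.Symplectic
open scoped ContDiff Topology

namespace Summit.SmoothPoincare4.SmoothPoincare4.Cruxes.TameOrBrodyR4.Sketch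

/-- Local notation for the model space `ℝ⁴ = EuclideanSpace ℝ (Fin 4)`. -/
local notation "E4" => EuclideanSpace ℝ (Fin 4)

namespace AdaptedMap

/-! ### The adapted map: smoothness and its differential along `{ω = 0}` -/

/-- The adapted map `E (ζ, ω) = v ζ + ω.re • e + ω.im • J (v ζ) e` is `C^∞`. -/
theorem contDiff_adapted (J : E4 → E4 →L[ℝ] E4) (hJs : ContDiff ℝ ∞ J) (v : ℂ → E4)
    (hv : ContDiff ℝ ∞ v) (e : E4) :
    ContDiff ℝ ∞ (fun p : ℂ × ℂ => v p.1 + (p.2.re : ℝ) • e + (p.2.im : ℝ) • J (v p.1) e) := by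
  have h1 : ContDiff ℝ ∞ (fun p : ℂ × ℂ => v p.1) := hv.comp contDiff_fst
  have h2 : ContDiff ℝ ∞ (fun p : ℂ × ℂ => (p.2.re : ℝ)) :=
    Complex.reCLM.contDiff.comp contDiff_snd
  have h3 : ContDiff ℝ ∞ (fun p : ℂ × ℂ => (p.2.im : ℝ)) :=
    Complex.imCLM.contDiff.comp contDiff_snd
  have h4 : ContDiff ℝ ∞ (fun p : ℂ × ℂ => J (v p.1) e) := (hJs.comp h1).clm_apply contDiff_const
  exact (h1.add (h2.smul contDiff_const)).add (h3.smul h4)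

/-- The differential of the adapted map at a point `(ζ, 0)` of the curve is
`(α, β) ↦ dv_ζ α + β.re • e + β.im • J (v ζ) e` (the `ω.im`-factor kills the derivative of
`J (v ζ) e`). -/
theorem hasFDerivAt_adapted (J : E4 → E4 →L[ℝ] E4) (hJs : ContDiff ℝ ∞ J) (v : ℂ → E4)
    (hv : ContDiff ℝ ∞ v) (e : E4) (ζ : ℂ) :
    HasFDerivAt (fun p : ℂ × ℂ => v p.1 + (p.2.re : ℝ) • e + (p.2.im : ℝ) • J (v p.1) e)
      ((fderiv ℝ v ζ).comp (ContinuousLinearMap.fst ℝ ℂ ℂ) +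
        (Complex.reCLM.comp (ContinuousLinearMap.snd ℝ ℂ ℂ)).smulRight e +
        (Complex.imCLM.comp (ContinuousLinearMap.snd ℝ ℂ ℂ)).smulRight (J (v ζ) e)) (ζ, 0) := by
  have h1 : HasFDerivAt (fun p : ℂ × ℂ => v p.1)
      ((fderiv ℝ v ζ).comp (ContinuousLinearMap.fst ℝ ℂ ℂ)) (ζ, 0) :=
    HasFDerivAt.comp ((ζ, 0) : ℂ × ℂ) (hv.differentiable (by simp) ζ).hasFDerivAt hasFDerivAt_fst
  have h2 : HasFDerivAt (fun p : ℂ × ℂ => (p.2.re : ℝ) • e)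
      ((Complex.reCLM.comp (ContinuousLinearMap.snd ℝ ℂ ℂ)).smulRight e) (ζ, 0) :=
    (Complex.reCLM.hasFDerivAt.comp ((ζ, 0) : ℂ × ℂ) hasFDerivAt_snd).smul_const e
  have h4 : HasFDerivAt (fun p : ℂ × ℂ => J (v p.1) e)
      (fderiv ℝ (fun p : ℂ × ℂ => J (v p.1) e) (ζ, 0)) (ζ, 0) :=
    ((((hJs.comp (hv.comp contDiff_fst)).clm_apply contDiff_const).differentiable (by simp))
      _).hasFDerivAt
  have h3 : HasFDerivAt (fun p : ℂ × ℂ => (p.2.im : ℝ) • J (v p.1) e)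
      ((Complex.imCLM.comp (ContinuousLinearMap.snd ℝ ℂ ℂ)).smulRight (J (v ζ) e)) (ζ, 0) := by
    have h := (Complex.imCLM.hasFDerivAt.comp ((ζ, 0) : ℂ × ℂ) hasFDerivAt_snd).fun_smul h4
    simpa using h
  exact (h1.add h2).add h3

/-- Evaluation of the differential of the adapted map at `(ζ, 0)`. -/
theorem fderiv_adapted_apply (J : E4 → E4 →L[ℝ] E4) (hJs : ContDiff ℝ ∞ J) (v : ℂ → E4)
    (hv : ContDiff ℝ ∞ v) (e : E4) (ζ α β : ℂ) :
    fderiv ℝ (fun p : ℂ × ℂ => v p.1 + (p.2.re : ℝ) • e + (p.2.im : ℝ) • J (v p.1) e) (ζ, 0)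
        (α, β) = fderiv ℝ v ζ α + (β.re : ℝ) • e + (β.im : ℝ) • J (v ζ) e := by
  rw [(hasFDerivAt_adapted J hJs v hv e ζ).fderiv]
  simp

/-- If `e` is not tangent to the curve at `ξ₁` and `dv_{ξ₁}` is injective, then the differential
of the adapted map at `(ξ₁, 0)` is injective (uses `J² = -1` and `J`-holomorphicity of `v`). -/
theorem injective_fderiv_adapted (J : E4 → E4 →L[ℝ] E4) (hJs : ContDiff ℝ ∞ J)
    (hJ2 : ∀ x v, J x (J x v) = -v) (v : ℂ → E4) (hv : ContDiff ℝ ∞ v)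
    (hvJ : IsJHolomorphicFlat J v) (ξ₁ : ℂ) (himm : Function.Injective (fderiv ℝ v ξ₁)) (e : E4)
    (he : ∀ z, fderiv ℝ v ξ₁ z ≠ e) :
    Function.Injective
      (fderiv ℝ (fun p : ℂ × ℂ => v p.1 + (p.2.re : ℝ) • e + (p.2.im : ℝ) • J (v p.1) e)
        (ξ₁, 0)) := by
  rw [injective_iff_map_eq_zero]
  rintro ⟨α, β⟩ h
  rw [fderiv_adapted_apply J hJs v hv] at h
  have h2 : J (v ξ₁) (fderiv ℝ v ξ₁ α + (β.re : ℝ) • e + (β.im : ℝ) • J (v ξ₁) e) = 0 := by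
    rw [h, map_zero]
  rw [map_add, map_add, map_smul, map_smul, hJ2, ← hvJ ξ₁ α] at h2
  have key : (β.re ^ 2 + β.im ^ 2) • e =
      β.im • fderiv ℝ v ξ₁ (Complex.I * α) - β.re • fderiv ℝ v ξ₁ α := by
    linear_combination (norm := module) β.re • h - β.im • h2
  have hβ0 : β.re ^ 2 + β.im ^ 2 = 0 := by
    by_contra hne
    apply he ((β.re ^ 2 + β.im ^ 2)⁻¹ • (β.im • (Complex.I * α) - β.re • α))
    rw [map_smul, map_sub, map_smul, map_smul, ← key, smul_smul, inv_mul_cancel₀ hne, one_smul]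
  have hre : β.re = 0 := by
    have h' : β.re ^ 2 = 0 := by linarith [sq_nonneg β.re, sq_nonneg β.im]
    exact (pow_eq_zero_iff two_ne_zero).1 h'
  have him : β.im = 0 := by
    have h' : β.im ^ 2 = 0 := by linarith [sq_nonneg β.re, sq_nonneg β.im]
    exact (pow_eq_zero_iff two_ne_zero).1 h'
  have hβ : β = 0 := Complex.ext hre him
  rw [hre, him, zero_smul, zero_smul, add_zero, add_zero] at h
  have hα : α = 0 := himm (by rw [h, map_zero])
  simp [hα, hβ]

/-! ### Linear algebra in `ℝ⁴` -/

/-- A real-linear map `ℂ → ℝ⁴` misses a vector (`2 < 4`). -/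
theorem exists_not_mem_range (L : ℂ →L[ℝ] E4) : ∃ e : E4, ∀ z, L z ≠ e := by
  by_contra h
  simp only [not_exists, not_forall, not_not] at h
  have hle := LinearMap.finrank_le_finrank_of_surjective (f := (L : ℂ →ₗ[ℝ] E4)) fun x => h x
  simp [Complex.finrank_real_complex] at hle

/-- An injective real-linear map `ℂ × ℂ → ℝ⁴` is a continuous linear equivalence (`4 = 4`). -/
theorem exists_equiv_of_injective (L : ℂ × ℂ →L[ℝ] E4) (h : Function.Injective L) :
    ∃ L' : (ℂ × ℂ) ≃L[ℝ] E4, (L' : ℂ × ℂ →L[ℝ] E4) = L := by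
  have hfin : Module.finrank ℝ (ℂ × ℂ) = Module.finrank ℝ E4 := by
    simp [Module.finrank_prod, Complex.finrank_real_complex, finrank_euclideanSpace]
  have hsurj : Function.Surjective L :=
    (LinearMap.injective_iff_surjective_of_finrank_eq_finrank hfin (f := (L : ℂ × ℂ →ₗ[ℝ] E4))).1 h
  exact ⟨ContinuousLinearEquiv.ofBijective L (LinearMap.ker_eq_bot.mpr h)
    (LinearMap.range_eq_top.mpr hsurj), ContinuousLinearEquiv.coe_ofBijective _ _ _⟩

/-! ### The inverse function theorem with quantitative domains -/

/-- If the differential of a `C^∞` map `ℂ × ℂ → ℝ⁴` is injective at `p₀`, then on a ball around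
`p₀` the differentials satisfy a uniform lower bound `‖q‖ ≤ B ‖dE_p q‖`. -/
theorem uniform_lower_bound {E : ℂ × ℂ → E4} (hE : ContDiff ℝ ∞ E) (p₀ : ℂ × ℂ)
    (hinj : Function.Injective (fderiv ℝ E p₀)) :
    ∃ r B : ℝ, 0 < r ∧ 0 ≤ B ∧ ∀ p ∈ ball p₀ r, ∀ q : ℂ × ℂ, ‖q‖ ≤ B * ‖fderiv ℝ E p q‖ := by
  obtain ⟨L, hL⟩ := exists_equiv_of_injective (fderiv ℝ E p₀) hinj
  set C : ℝ := ‖(L.symm : E4 →L[ℝ] ℂ × ℂ)‖ with hC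
  have hC0 : 0 ≤ C := norm_nonneg _
  -- the lower bound at `p₀`
  have h0 : ∀ q : ℂ × ℂ, ‖q‖ ≤ C * ‖fderiv ℝ E p₀ q‖ := by
    intro q
    have h1 : (L.symm : E4 →L[ℝ] ℂ × ℂ) (fderiv ℝ E p₀ q) = q := by
      rw [← hL]
      exact L.symm_apply_apply q
    calc ‖q‖ = ‖(L.symm : E4 →L[ℝ] ℂ × ℂ) (fderiv ℝ E p₀ q)‖ := by rw [h1]
      _ ≤ C * ‖fderiv ℝ E p₀ q‖ := (L.symm : E4 →L[ℝ] ℂ × ℂ).le_opNorm _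
  -- continuity of the differential
  have hcont : ContinuousAt (fderiv ℝ E) p₀ := (hE.continuous_fderiv (by simp)).continuousAt
  set ε : ℝ := 1 / (2 * (C + 1)) with hε_def
  have hε : 0 < ε := by positivity
  have hCε : C * ε ≤ 1 / 2 := by
    rw [hε_def, mul_one_div, div_le_div_iff₀ (by positivity) (by norm_num)]
    linarith
  obtain ⟨r, hr, hball⟩ := Metric.continuousAt_iff.1 hcont ε hε
  refine ⟨r, 2 * C, hr, by positivity, ?_⟩
  intro p hp q
  have hdp : ‖fderiv ℝ E p - fderiv ℝ E p₀‖ < ε := by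
    rw [← dist_eq_norm]
    exact hball hp
  have h1 : ‖fderiv ℝ E p₀ q‖ ≤ ‖fderiv ℝ E p q‖ + ‖(fderiv ℝ E p - fderiv ℝ E p₀) q‖ := by
    have h' : fderiv ℝ E p₀ q = fderiv ℝ E p q - (fderiv ℝ E p - fderiv ℝ E p₀) q := by
      simp
    rw [h']
    exact norm_sub_le _ _
  have h2 : ‖(fderiv ℝ E p - fderiv ℝ E p₀) q‖ ≤ ε * ‖q‖ :=
    (ContinuousLinearMap.le_opNorm _ _).trans (mul_le_mul_of_nonneg_right hdp.le (norm_nonneg _))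
  have h3 : ‖q‖ ≤ C * ‖fderiv ℝ E p q‖ + C * ε * ‖q‖ := by
    calc ‖q‖ ≤ C * ‖fderiv ℝ E p₀ q‖ := h0 q
      _ ≤ C * (‖fderiv ℝ E p q‖ + ε * ‖q‖) :=
          mul_le_mul_of_nonneg_left (h1.trans (by linarith)) hC0
      _ = C * ‖fderiv ℝ E p q‖ + C * ε * ‖q‖ := by ring
  have h4 : C * ε * ‖q‖ ≤ 1 / 2 * ‖q‖ := mul_le_mul_of_nonneg_right hCε (norm_nonneg q)
  linarith

/-- **Quantitative inverse function theorem.** A `C^∞` map `E : ℂ × ℂ → ℝ⁴` with injective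
differential at `p₀` has a local inverse `Λ`, `C^∞` on a ball `ball (E p₀) δ` which it maps into
a ball `ball p₀ r` on which `Λ ∘ E = id` and the differentials of `E` are uniformly bounded
below. -/
theorem local_inverse {E : ℂ × ℂ → E4} (hE : ContDiff ℝ ∞ E) (p₀ : ℂ × ℂ) (x₀ : E4)
    (hx₀ : E p₀ = x₀) (hinj : Function.Injective (fderiv ℝ E p₀)) :
    ∃ (Λ : E4 → ℂ × ℂ) (r δ B : ℝ), 0 < r ∧ 0 < δ ∧ 0 ≤ B ∧
      ContDiffOn ℝ ∞ Λ (ball x₀ δ) ∧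
      (∀ p ∈ ball p₀ r, Λ (E p) = p) ∧
      (∀ x ∈ ball x₀ δ, Λ x ∈ ball p₀ r ∧ E (Λ x) = x) ∧
      (∀ p ∈ ball p₀ r, ∀ q : ℂ × ℂ, ‖q‖ ≤ B * ‖fderiv ℝ E p q‖) := by
  obtain ⟨r₁, B, hr₁, hB, hbound⟩ := uniform_lower_bound hE p₀ hinj
  -- the differential is injective, hence an equivalence, on the whole ball
  have hinj' : ∀ p ∈ ball p₀ r₁, Function.Injective (fderiv ℝ E p) := by
    intro p hp q₁ q₂ hq
    rw [← sub_eq_zero, ← norm_le_zero_iff]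
    have h := hbound p hp (q₁ - q₂)
    rwa [map_sub, hq, sub_self, norm_zero, mul_zero] at h
  have hequiv : ∀ p ∈ ball p₀ r₁,
      ∃ L : (ℂ × ℂ) ≃L[ℝ] E4, HasStrictFDerivAt E (L : ℂ × ℂ →L[ℝ] E4) p := by
    intro p hp
    obtain ⟨L, hL⟩ := exists_equiv_of_injective _ (hinj' p hp)
    exact ⟨L, by rw [hL]; exact hE.contDiffAt.hasStrictFDerivAt (by simp)⟩
  obtain ⟨L₀, hL₀⟩ := hequiv p₀ (mem_ball_self hr₁)
  set Φ := hL₀.toOpenPartialHomeomorph E with hΦ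
  have hp₀ : p₀ ∈ Φ.source := hL₀.mem_toOpenPartialHomeomorph_source
  obtain ⟨r₂, hr₂, hball₂⟩ := Metric.isOpen_iff.1 Φ.open_source p₀ hp₀
  set r := min r₁ r₂ with hr_def
  have hr : 0 < r := lt_min hr₁ hr₂
  have hsub₁ : ball p₀ r ⊆ ball p₀ r₁ := ball_subset_ball (min_le_left _ _)
  have hsub₂ : ball p₀ r ⊆ Φ.source := (ball_subset_ball (min_le_right _ _)).trans hball₂
  have hΦp₀ : Φ p₀ = x₀ := hx₀
  have hx₀T : x₀ ∈ Φ.target := hΦp₀ ▸ Φ.map_source hp₀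
  have hsymm₀ : Φ.symm x₀ = p₀ := by
    rw [← hΦp₀]
    exact Φ.left_inv hp₀
  -- the radius `δ`
  have hnhds : Φ.target ∩ Φ.symm ⁻¹' ball p₀ r ∈ 𝓝 x₀ := by
    refine inter_mem (Φ.open_target.mem_nhds hx₀T) ?_
    apply (Φ.continuousAt_symm hx₀T).preimage_mem_nhds
    rw [hsymm₀]
    exact ball_mem_nhds p₀ hr
  obtain ⟨δ, hδ, hballδ⟩ := Metric.mem_nhds_iff.1 hnhds
  refine ⟨Φ.symm, r, δ, B, hr, hδ, hB, ?_, ?_, ?_, fun p hp q => hbound p (hsub₁ hp) q⟩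
  · -- smoothness of the inverse on `ball x₀ δ ⊆ Φ.target`
    intro x hx
    obtain ⟨hxT, hxr⟩ := hballδ hx
    obtain ⟨L, hL⟩ := hequiv (Φ.symm x) (hsub₁ hxr)
    exact (Φ.contDiffAt_symm hxT hL.hasFDerivAt hE.contDiffAt).contDiffWithinAt
  · intro p hp
    exact Φ.left_inv (hsub₂ hp)
  · intro x hx
    obtain ⟨hxT, hxr⟩ := hballδ hx
    exact ⟨hxr, Φ.right_inv hxT⟩

end AdaptedMap

/-- (AC-a) the adapted map along a `J`-holomorphic curve is smooth, restricts to the curve on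
`{w = 0}`, and is `J`-complex-linear along `{w = 0}` — for every choice of the vector `e`. -/
theorem helper_adaptedMapHol (J : E4 → E4 →L[ℝ] E4) (hJs : ContDiff ℝ ∞ J)
    (hJ2 : ∀ x v, J x (J x v) = -v) (v : ℂ → E4) (hv : ContDiff ℝ ∞ v)
    (hvJ : IsJHolomorphicFlat J v) (e : E4) :
    ContDiff ℝ ∞ (fun p : ℂ × ℂ => v p.1 + (p.2.re : ℝ) • e + (p.2.im : ℝ) • J (v p.1) e) ∧
    (∀ ζ : ℂ, (fun p : ℂ × ℂ => v p.1 + (p.2.re : ℝ) • e + (p.2.im : ℝ) • J (v p.1) e) (ζ, 0) = v ζ) ∧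
    (∀ ζ α β : ℂ, J (v ζ)
        (fderiv ℝ (fun p : ℂ × ℂ => v p.1 + (p.2.re : ℝ) • e + (p.2.im : ℝ) • J (v p.1) e) (ζ, 0)
          (α, β)) =
      fderiv ℝ (fun p : ℂ × ℂ => v p.1 + (p.2.re : ℝ) • e + (p.2.im : ℝ) • J (v p.1) e) (ζ, 0)
        (Complex.I * α, Complex.I * β)) := by
  refine ⟨AdaptedMap.contDiff_adapted J hJs v hv e, fun ζ => by simp, fun ζ α β => ?_⟩
  rw [AdaptedMap.fderiv_adapted_apply J hJs v hv e ζ,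
    AdaptedMap.fderiv_adapted_apply J hJs v hv e ζ, map_add, map_add, map_smul, map_smul, hJ2,
    ← hvJ ζ α]
  simp only [Complex.mul_re, Complex.mul_im, Complex.I_re, Complex.I_im, zero_mul, one_mul,
    zero_sub, zero_add, smul_neg, neg_smul]
  abel

/-- (AC-b) for a suitable `e` the adapted map is a local diffeomorphism at `(ξ₁, 0)` onto a
neighbourhood of `v ξ₁`, with a smooth local inverse and quantitative domains. -/
theorem helper_adaptedMapInverse (J : E4 → E4 →L[ℝ] E4) (hJs : ContDiff ℝ ∞ J)
    (hJ2 : ∀ x v, J x (J x v) = -v) (v : ℂ → E4) (hv : ContDiff ℝ ∞ v)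
    (hvJ : IsJHolomorphicFlat J v) (ξ₁ : ℂ) (himm : Function.Injective (fderiv ℝ v ξ₁)) :
    ∃ (e : E4) (Λ : E4 → ℂ × ℂ) (r δ B : ℝ), 0 < r ∧ 0 < δ ∧ 0 ≤ B ∧
      ContDiffOn ℝ ∞ Λ (ball (v ξ₁) δ) ∧
      (∀ p ∈ ball ((ξ₁, 0) : ℂ × ℂ) r,
        Λ ((fun p : ℂ × ℂ => v p.1 + (p.2.re : ℝ) • e + (p.2.im : ℝ) • J (v p.1) e) p) = p) ∧
      (∀ x ∈ ball (v ξ₁) δ, Λ x ∈ ball ((ξ₁, 0) : ℂ × ℂ) r ∧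
        (fun p : ℂ × ℂ => v p.1 + (p.2.re : ℝ) • e + (p.2.im : ℝ) • J (v p.1) e) (Λ x) = x) ∧
      (∀ p ∈ ball ((ξ₁, 0) : ℂ × ℂ) r, ∀ q : ℂ × ℂ,
        ‖q‖ ≤ B * ‖fderiv ℝ (fun p : ℂ × ℂ => v p.1 + (p.2.re : ℝ) • e + (p.2.im : ℝ) • J (v p.1) e)
          p q‖) := by
  obtain ⟨e, he⟩ := AdaptedMap.exists_not_mem_range (fderiv ℝ v ξ₁)
  have hE := AdaptedMap.contDiff_adapted J hJs v hv e
  have hinj := AdaptedMap.injective_fderiv_adapted J hJs hJ2 v hv hvJ ξ₁ himm e he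
  obtain ⟨Λ, r, δ, B, h⟩ := AdaptedMap.local_inverse hE ((ξ₁, 0) : ℂ × ℂ) (v ξ₁) (by simp) hinj
  exact ⟨e, Λ, r, δ, B, h⟩

end Summit.SmoothPoincare4.SmoothPoincare4.Cruxes.TameOrBrodyR4.Sketch
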